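import Mathlib
import Summits.Ventures.PercRepro2.CoinChainXAGateBridge
import Summits.Ventures.PercRepro2.CoinChainXAMjGate
import Summits.Ventures.PercRepro2.CoinChainXAJjGateAlg

/-!
# The `jj′` gate of the (j, j′) pair is a theorem of the chain
(blind cell PercRepro2, night-2 g31; proofs/NIGHT2-DARC.md §73)

For `ent = {m}`, any `ent' ∋ j, j'`, the entry markers and the principal-filter gate
`d' = d·1[{j, j'} ⊆ W]` (the `jj′` corner of §71.9 — the first corner of the programme whose gate is open
on coin-entered clusters), the cleared (XA′) holds: the general-gate bridge `chain_XA'_gate_of_parts`,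
the gate sums (`νd·x·y` on both regions, so every gate sum on `D′` is `XYU` and every gate sum on `M` is
`XYM`), the facts of the parts model — two new ones, `cg_fact_DD2` (the coin-entered `y`-marked clusters
against the coin-entered surviving `x`-marked ones, meeting in the `m`-free clusters and joining in the
`xy`-marked coin-entered ones) and `cg_fact_JM2` (the piecewise killed law with the marker `x` against the
sure-entered `y`-marked clusters: the killed-vs-sure-entered two-marker fact) — and the 157-term
certificate `cg_jj_full`.  No log-supermodularity of `d` is needed.
-/

namespace Summit.Ventures.PercRepro2.Coin

open Classical

section JjFacts

variable {V : Type*} [DecidableEq V] {R : Type*} [Field R] [LinearOrder R] [IsStrictOrderedRing R]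
variable (U ent ent' : Finset V) (ν c d : Finset V → R)
variable (hν0 : ∀ W, 0 ≤ ν W) (hν : ∀ s ⊆ U, ∀ t ⊆ U, ν s * ν t ≤ ν (s ∩ t) * ν (s ∪ t))
  (hc0 : ∀ W, 0 ≤ c W) (hd0 : ∀ W, 0 ≤ d W) (hdc : ∀ W, d W ≤ c W)
  (hcd : ∀ s t, c s * d t ≤ c (s ∩ t) * d (s ∪ t))
  (hratio : ∀ s t, s ⊆ t → d s * c t ≤ c s * d t)

include hν0 hν hc0 hd0 hcd in
/-- **The coin-entered `y`-marked clusters against the coin-entered surviving `x`-marked ones** (`DD_xy`):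
the meet is `ent`-free, the join is a coin-entered cluster carrying both markers. -/
theorem cg_fact_DD2 (x y : Finset V → R) (hx0 : ∀ W, 0 ≤ x W) (hy0 : ∀ W, 0 ≤ y W)
    (hxm : ∀ s t, x s ≤ x (s ∪ t)) (hym : ∀ s t, y s ≤ y (s ∪ t)) :
    (∑ W ∈ U.powerset.filter (fun W => (¬ ∃ r ∈ ent, r ∈ W) ∧ ∃ r ∈ ent', r ∈ W), ν W * c W * y W)
      * (∑ W ∈ U.powerset.filter (fun W => (¬ ∃ r ∈ ent, r ∈ W) ∧ ∃ r ∈ ent', r ∈ W), ν W * d W * x W) ≤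
    (∑ W ∈ U.powerset.filter (fun W => ¬ ∃ r ∈ ent, r ∈ W), ν W * c W)
      * (∑ W ∈ U.powerset.filter (fun W => (¬ ∃ r ∈ ent, r ∈ W) ∧ ∃ r ∈ ent', r ∈ W), ν W * d W * (x W * y W)) := by
  refine ad_sets_dec U (fun W => ν W * c W * y W) (fun W => ν W * d W * x W)
    (fun W => ν W * c W) (fun W => ν W * d W * (x W * y W))
    (fun W => mul_nonneg (mul_nonneg (hν0 W) (hc0 W)) (hy0 W))
    (fun W => mul_nonneg (mul_nonneg (hν0 W) (hd0 W)) (hx0 W))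
    (fun W => mul_nonneg (hν0 W) (hc0 W))
    (fun W => mul_nonneg (mul_nonneg (hν0 W) (hd0 W)) (mul_nonneg (hx0 W) (hy0 W)))
    (fun W => (¬ ∃ r ∈ ent, r ∈ W) ∧ ∃ r ∈ ent', r ∈ W) (fun W => (¬ ∃ r ∈ ent, r ∈ W) ∧ ∃ r ∈ ent', r ∈ W)
    (fun W => ¬ ∃ r ∈ ent, r ∈ W) (fun W => (¬ ∃ r ∈ ent, r ∈ W) ∧ ∃ r ∈ ent', r ∈ W) ?_
  intro s hs t ht hA hB
  refine ⟨fun ⟨r, hr, hrW⟩ => hA.1 ⟨r, hr, (Finset.mem_inter.1 hrW).1⟩, ⟨?_, ?_⟩, ?_⟩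
  · rintro ⟨r, hr, hrW⟩
    rcases Finset.mem_union.1 hrW with h | h
    · exact hA.1 ⟨r, hr, h⟩
    · exact hB.1 ⟨r, hr, h⟩
  · obtain ⟨r, hr, hrt⟩ := hB.2
    exact ⟨r, hr, Finset.mem_union.2 (Or.inr hrt)⟩
  · have hxt : x t ≤ x (s ∪ t) := by rw [Finset.union_comm]; exact hxm t s
    calc ν s * c s * y s * (ν t * d t * x t) = ((ν s * ν t) * (c s * d t)) * (x t * y s) := by ring
      _ ≤ ((ν (s ∩ t) * ν (s ∪ t)) * (c (s ∩ t) * d (s ∪ t))) * (x (s ∪ t) * y (s ∪ t)) :=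
          mul_le_mul (mul_le_mul (hν s hs t ht) (hcd s t) (mul_nonneg (hc0 s) (hd0 t))
            (mul_nonneg (hν0 _) (hν0 _)))
            (mul_le_mul hxt (hym s t) (hy0 s) (hx0 _)) (mul_nonneg (hx0 t) (hy0 s))
            (mul_nonneg (mul_nonneg (hν0 _) (hν0 _)) (mul_nonneg (hc0 _) (hd0 _)))
      _ = ν (s ∩ t) * c (s ∩ t) * (ν (s ∪ t) * d (s ∪ t) * (x (s ∪ t) * y (s ∪ t))) := by ring

include hν0 hν hc0 hd0 hdc hcd hratio in
/-- **The piecewise killed law with the marker `x` against the sure-entered `y`-marked clusters**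
(`JM_xy`): the meet is `ent`-free, the join a sure-entered cluster carrying both markers. -/
theorem cg_fact_JM2 (x y : Finset V → R) (hx0 : ∀ W, 0 ≤ x W) (hy0 : ∀ W, 0 ≤ y W)
    (hxm : ∀ s t, x s ≤ x (s ∪ t)) (hym : ∀ s t, y s ≤ y (s ∪ t)) :
    (∑ W ∈ U.powerset.filter (fun W => ¬ ∃ r ∈ ent, r ∈ W), ν W * (if ∃ r ∈ ent', r ∈ W then c W - d W else c W) * x W)
      * (∑ W ∈ U.powerset.filter (fun W => ∃ r ∈ ent, r ∈ W), ν W * d W * y W) ≤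
    (∑ W ∈ U.powerset.filter (fun W => ¬ ∃ r ∈ ent, r ∈ W), ν W * (if ∃ r ∈ ent', r ∈ W then c W - d W else c W))
      * (∑ W ∈ U.powerset.filter (fun W => ∃ r ∈ ent, r ∈ W), ν W * d W * (x W * y W)) := by
  have hpw0 : ∀ W, 0 ≤ (if ∃ r ∈ ent', r ∈ W then c W - d W else c W) := fun W => by
    split_ifs <;> linarith [hdc W, hc0 W]
  refine ad_sets_dec U (fun W => ν W * (if ∃ r ∈ ent', r ∈ W then c W - d W else c W) * x W)
    (fun W => ν W * d W * y W)
    (fun W => ν W * (if ∃ r ∈ ent', r ∈ W then c W - d W else c W)) (fun W => ν W * d W * (x W * y W))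
    (fun W => mul_nonneg (mul_nonneg (hν0 W) (hpw0 W)) (hx0 W))
    (fun W => mul_nonneg (mul_nonneg (hν0 W) (hd0 W)) (hy0 W)) (fun W => mul_nonneg (hν0 W) (hpw0 W))
    (fun W => mul_nonneg (mul_nonneg (hν0 W) (hd0 W)) (mul_nonneg (hx0 W) (hy0 W)))
    (fun W => ¬ ∃ r ∈ ent, r ∈ W) (fun W => ∃ r ∈ ent, r ∈ W)
    (fun W => ¬ ∃ r ∈ ent, r ∈ W) (fun W => ∃ r ∈ ent, r ∈ W) ?_
  intro s hs t ht hA hB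
  refine ⟨fun ⟨r, hr, hrW⟩ => hA ⟨r, hr, (Finset.mem_inter.1 hrW).1⟩,
    by obtain ⟨r, hr, hrW⟩ := hB; exact ⟨r, hr, Finset.mem_union.2 (Or.inr hrW)⟩, ?_⟩
  have hyt : y t ≤ y (s ∪ t) := by rw [Finset.union_comm]; exact hym t s
  calc ν s * (if ∃ r ∈ ent', r ∈ s then c s - d s else c s) * x s * (ν t * d t * y t)
      = ((ν s * ν t) * ((if ∃ r ∈ ent', r ∈ s then c s - d s else c s) * d t)) * (x s * y t) := by ring
    _ ≤ ((ν (s ∩ t) * ν (s ∪ t)) * ((if ∃ r ∈ ent', r ∈ s ∩ t then c (s ∩ t) - d (s ∩ t) else c (s ∩ t)) * d (s ∪ t)))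
          * (x (s ∪ t) * y (s ∪ t)) :=
        mul_le_mul (mul_le_mul (hν s hs t ht) (cg_piece_pw ent' c d hc0 hd0 hdc hcd hratio s t)
            (mul_nonneg (hpw0 s) (hd0 t)) (mul_nonneg (hν0 _) (hν0 _)))
          (mul_le_mul (hxm s t) hyt (hy0 t) (hx0 _)) (mul_nonneg (hx0 s) (hy0 t))
          (mul_nonneg (mul_nonneg (hν0 _) (hν0 _)) (mul_nonneg (hpw0 _) (hd0 _)))
    _ = ν (s ∩ t) * (if ∃ r ∈ ent', r ∈ s ∩ t then c (s ∩ t) - d (s ∩ t) else c (s ∩ t))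
          * (ν (s ∪ t) * d (s ∪ t) * (x (s ∪ t) * y (s ∪ t))) := by ring

end JjFacts

section JjGateSums

variable {V : Type*} [DecidableEq V] {R : Type*} [Field R] [LinearOrder R] [IsStrictOrderedRing R]
variable (U : Finset V) (j j' : V) (ν d : Finset V → R)

omit [LinearOrder R] [IsStrictOrderedRing R] in
/-- The `jj′` gate is `d·x·y` (weighted by any `z` equal to `1` on the gate's support). -/
theorem jj_gate_sum (P : Finset V → Prop) [DecidablePred P] (x y z : Finset V → R)
    (hx : ∀ W, x W = if j ∈ W then 1 else 0) (hy : ∀ W, y W = if j' ∈ W then 1 else 0)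
    (hz : ∀ W, j ∈ W → j' ∈ W → z W = 1) :
    ∑ W ∈ U.powerset.filter P, ν W * (if j ∈ W ∧ j' ∈ W then d W else 0) * z W =
      ∑ W ∈ U.powerset.filter P, ν W * d W * (x W * y W) :=
  Finset.sum_congr rfl (fun W _ => by
    rw [hx W, hy W]
    by_cases hjj : j ∈ W ∧ j' ∈ W
    · rw [if_pos hjj, if_pos hjj.1, if_pos hjj.2, hz W hjj.1 hjj.2]; ring
    · rw [if_neg hjj]
      by_cases h1 : j ∈ W
      · have h2 : j' ∉ W := fun h => hjj ⟨h1, h⟩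
        rw [if_pos h1, if_neg h2]; ring
      · rw [if_neg h1]; ring)

omit [LinearOrder R] [IsStrictOrderedRing R] in
/-- The `jj′` gate is `d·x·y` (no weight). -/
theorem jj_gate_sum' (P : Finset V → Prop) [DecidablePred P] (x y : Finset V → R)
    (hx : ∀ W, x W = if j ∈ W then 1 else 0) (hy : ∀ W, y W = if j' ∈ W then 1 else 0) :
    ∑ W ∈ U.powerset.filter P, ν W * (if j ∈ W ∧ j' ∈ W then d W else 0) =
      ∑ W ∈ U.powerset.filter P, ν W * d W * (x W * y W) :=
  Finset.sum_congr rfl (fun W _ => by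
    rw [hx W, hy W]
    by_cases hjj : j ∈ W ∧ j' ∈ W
    · rw [if_pos hjj, if_pos hjj.1, if_pos hjj.2]; ring
    · rw [if_neg hjj]
      by_cases h1 : j ∈ W
      · have h2 : j' ∉ W := fun h => hjj ⟨h1, h⟩
        rw [if_pos h1, if_neg h2]; ring
      · rw [if_neg h1]; ring)

omit [DecidableEq V] in
/-- The unmarked part of a law with two `[0, 1]`-markers is nonnegative (inclusion–exclusion box fact). -/
theorem jj_box_ie (P : Finset V → Prop) [DecidablePred P] (x y : Finset V → R)
    (hν0 : ∀ W, 0 ≤ ν W) (hd0 : ∀ W, 0 ≤ d W) (hx1 : ∀ W, x W ≤ 1) (hy1 : ∀ W, y W ≤ 1) :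
    0 ≤ (∑ W ∈ U.powerset.filter P, ν W * d W) + (∑ W ∈ U.powerset.filter P, ν W * d W * (x W * y W))
      - (∑ W ∈ U.powerset.filter P, ν W * d W * x W) - (∑ W ∈ U.powerset.filter P, ν W * d W * y W) := by
  rw [← Finset.sum_add_distrib, ← Finset.sum_sub_distrib, ← Finset.sum_sub_distrib]
  refine Finset.sum_nonneg (fun W _ => ?_)
  have : ν W * d W + ν W * d W * (x W * y W) - ν W * d W * x W - ν W * d W * y W
      = ν W * d W * ((1 - x W) * (1 - y W)) := by ring
  rw [this]
  exact mul_nonneg (mul_nonneg (hν0 W) (hd0 W)) (mul_nonneg (by linarith [hx1 W]) (by linarith [hy1 W]))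

end JjGateSums

section JjGateMain

variable {V : Type*} [DecidableEq V] {R : Type*} [Field R] [LinearOrder R] [IsStrictOrderedRing R]

set_option maxHeartbeats 1600000 in
/-- **THE `jj′` GATE IS A THEOREM OF THE CHAIN**: for `ent = {m}`, any `ent' ∋ j, j'`, the entry markers
`x = 1[j ∈ ·]`, `y = 1[j' ∈ ·]` and the gate `d' = d·1[{j, j'} ⊆ W]`, the cleared (XA′) holds under
`hν0`, `hν`, `hc0`, `hd0`, `hdc`, `hcd`, `hratio` (no log-supermodularity of `d` is needed). -/
theorem chain_XA'_jj_gate (U : Finset V) (m j j' : V) (ent' : Finset V) (ν c d : Finset V → R)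
    (hj : j ∈ ent') (hj' : j' ∈ ent')
    (hν0 : ∀ W, 0 ≤ ν W) (hν : ∀ s ⊆ U, ∀ t ⊆ U, ν s * ν t ≤ ν (s ∩ t) * ν (s ∪ t))
    (hc0 : ∀ W, 0 ≤ c W) (hd0 : ∀ W, 0 ≤ d W) (hdc : ∀ W, d W ≤ c W)
    (hcd : ∀ s t, c s * d t ≤ c (s ∩ t) * d (s ∪ t))
    (hratio : ∀ s t, s ⊆ t → d s * c t ≤ c s * d t)
    (x y : Finset V → R) (hx : ∀ W, x W = if j ∈ W then 1 else 0) (hy : ∀ W, y W = if j' ∈ W then 1 else 0) :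
    (((∑ W ∈ U.powerset, ν W * chainMix {m} ent' 0 c d W) * (∑ W ∈ U.powerset, ν W * chainMix {m} ent' 1 c d W * x W) - (∑ W ∈ U.powerset, ν W * chainMix {m} ent' 0 c d W * x W) * (∑ W ∈ U.powerset, ν W * chainMix {m} ent' 1 c d W)) *
          ((∑ W ∈ U.powerset, ν W * chainMix {m} ent' 0 c d W) * (∑ W ∈ U.powerset, ν W * chainMix {m} ent' 0 c (fun W => if j ∈ W ∧ j' ∈ W then d W else 0) W * y W) - (∑ W ∈ U.powerset, ν W * chainMix {m} ent' 0 c d W * y W) * (∑ W ∈ U.powerset, ν W * chainMix {m} ent' 0 c (fun W => if j ∈ W ∧ j' ∈ W then d W else 0) W))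
        + ((∑ W ∈ U.powerset, ν W * chainMix {m} ent' 0 c d W) * (∑ W ∈ U.powerset, ν W * chainMix {m} ent' 1 c d W * y W) - (∑ W ∈ U.powerset, ν W * chainMix {m} ent' 0 c d W * y W) * (∑ W ∈ U.powerset, ν W * chainMix {m} ent' 1 c d W)) *
          ((∑ W ∈ U.powerset, ν W * chainMix {m} ent' 0 c d W) * (∑ W ∈ U.powerset, ν W * chainMix {m} ent' 0 c (fun W => if j ∈ W ∧ j' ∈ W then d W else 0) W * x W) - (∑ W ∈ U.powerset, ν W * chainMix {m} ent' 0 c d W * x W) * (∑ W ∈ U.powerset, ν W * chainMix {m} ent' 0 c (fun W => if j ∈ W ∧ j' ∈ W then d W else 0) W))) ≤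
        (∑ W ∈ U.powerset, ν W * chainMix {m} ent' 0 c d W) * ((∑ W ∈ U.powerset, ν W * chainMix {m} ent' 0 c d W) * (∑ W ∈ U.powerset, ν W * chainMix {m} ent' 0 c d W) * (∑ W ∈ U.powerset, ν W * chainMix {m} ent' 1 c (fun W => if j ∈ W ∧ j' ∈ W then d W else 0) W * (x W * y W))
          - (∑ W ∈ U.powerset, ν W * chainMix {m} ent' 0 c d W) * (∑ W ∈ U.powerset, ν W * chainMix {m} ent' 0 c d W * y W) * (∑ W ∈ U.powerset, ν W * chainMix {m} ent' 1 c (fun W => if j ∈ W ∧ j' ∈ W then d W else 0) W * x W)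
          - (∑ W ∈ U.powerset, ν W * chainMix {m} ent' 0 c d W) * (∑ W ∈ U.powerset, ν W * chainMix {m} ent' 0 c d W * x W) * (∑ W ∈ U.powerset, ν W * chainMix {m} ent' 1 c (fun W => if j ∈ W ∧ j' ∈ W then d W else 0) W * y W)
          + (∑ W ∈ U.powerset, ν W * chainMix {m} ent' 0 c d W * x W) * (∑ W ∈ U.powerset, ν W * chainMix {m} ent' 0 c d W * y W) * (∑ W ∈ U.powerset, ν W * chainMix {m} ent' 1 c (fun W => if j ∈ W ∧ j' ∈ W then d W else 0) W)) := by
  have hx0 : ∀ W, 0 ≤ x W := fun W => by rw [hx W]; split_ifs <;> norm_num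
  have hy0 : ∀ W, 0 ≤ y W := fun W => by rw [hy W]; split_ifs <;> norm_num
  have hx1 : ∀ W, x W ≤ 1 := fun W => by rw [hx W]; split_ifs <;> norm_num
  have hy1 : ∀ W, y W ≤ 1 := fun W => by rw [hy W]; split_ifs <;> norm_num
  have hxm : ∀ s t, x s ≤ x (s ∪ t) := fun s t => by
    rw [hx s, hx (s ∪ t)]
    by_cases h : j ∈ s
    · rw [if_pos h, if_pos (Finset.mem_union_left t h)]
    · rw [if_neg h]; split_ifs <;> norm_num
  have hym : ∀ s t, y s ≤ y (s ∪ t) := fun s t => by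
    rw [hy s, hy (s ∪ t)]
    by_cases h : j' ∈ s
    · rw [if_pos h, if_pos (Finset.mem_union_left t h)]
    · rw [if_neg h]; split_ifs <;> norm_num
  have hxI : ∀ W, (¬ ∃ r ∈ ({m} : Finset V) ∪ ent', r ∈ W) → x W = 0 := fun W hW => by
    rw [hx W]; exact if_neg (fun h => hW ⟨j, Finset.mem_union.2 (Or.inr hj), h⟩)
  have hyI : ∀ W, (¬ ∃ r ∈ ({m} : Finset V) ∪ ent', r ∈ W) → y W = 0 := fun W hW => by
    rw [hy W]; exact if_neg (fun h => hW ⟨j', Finset.mem_union.2 (Or.inr hj'), h⟩)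
  have hzx : ∀ W, j ∈ W → j' ∈ W → x W = 1 := fun W h _ => by rw [hx W, if_pos h]
  have hzy : ∀ W, j ∈ W → j' ∈ W → y W = 1 := fun W _ h => by rw [hy W, if_pos h]
  have hzxy : ∀ W, j ∈ W → j' ∈ W → x W * y W = 1 := fun W h h' => by rw [hx W, hy W, if_pos h, if_pos h']; ring
  refine chain_XA'_gate_of_parts U m j j' ent' ν c d (fun W => if j ∈ W ∧ j' ∈ W then d W else 0) hj hj' x y hx hy ?_
  have eD0 := jj_gate_sum' U j j' ν d (fun W => (¬ ∃ r ∈ ({m} : Finset V), r ∈ W) ∧ ∃ r ∈ ent', r ∈ W) x y hx hy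
  have eDx := jj_gate_sum U j j' ν d (fun W => (¬ ∃ r ∈ ({m} : Finset V), r ∈ W) ∧ ∃ r ∈ ent', r ∈ W) x y x hx hy hzx
  have eDy := jj_gate_sum U j j' ν d (fun W => (¬ ∃ r ∈ ({m} : Finset V), r ∈ W) ∧ ∃ r ∈ ent', r ∈ W) x y y hx hy hzy
  have eDxy := jj_gate_sum U j j' ν d (fun W => (¬ ∃ r ∈ ({m} : Finset V), r ∈ W) ∧ ∃ r ∈ ent', r ∈ W) x y (fun W => x W * y W) hx hy hzxy
  have eM0 := jj_gate_sum' U j j' ν d (fun W => ∃ r ∈ ({m} : Finset V), r ∈ W) x y hx hy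
  have eMx := jj_gate_sum U j j' ν d (fun W => ∃ r ∈ ({m} : Finset V), r ∈ W) x y x hx hy hzx
  have eMy := jj_gate_sum U j j' ν d (fun W => ∃ r ∈ ({m} : Finset V), r ∈ W) x y y hx hy hzy
  have eMxy := jj_gate_sum U j j' ν d (fun W => ∃ r ∈ ({m} : Finset V), r ∈ W) x y (fun W => x W * y W) hx hy hzxy
  rw [eD0, eDx, eDy, eDxy, eM0, eMx, eMy, eMxy]
  -- the part sums
  set a := (∑ W ∈ U.powerset.filter (fun W => ¬ ∃ r ∈ ({m} : Finset V) ∪ ent', r ∈ W), ν W * c W) with ha_def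
  set δ := (∑ W ∈ U.powerset.filter (fun W => (¬ ∃ r ∈ ({m} : Finset V), r ∈ W) ∧ ∃ r ∈ ent', r ∈ W), ν W * (c W - d W)) with hδ_def
  set u := (∑ W ∈ U.powerset.filter (fun W => (¬ ∃ r ∈ ({m} : Finset V), r ∈ W) ∧ ∃ r ∈ ent', r ∈ W), ν W * d W) with hu_def
  set t := (∑ W ∈ U.powerset.filter (fun W => ∃ r ∈ ({m} : Finset V), r ∈ W), ν W * d W) with ht_def
  set XJ := (∑ W ∈ U.powerset.filter (fun W => (¬ ∃ r ∈ ({m} : Finset V), r ∈ W) ∧ ∃ r ∈ ent', r ∈ W), ν W * (c W - d W) * x W) with hXJ_def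
  set XU := (∑ W ∈ U.powerset.filter (fun W => (¬ ∃ r ∈ ({m} : Finset V), r ∈ W) ∧ ∃ r ∈ ent', r ∈ W), ν W * d W * x W) with hXU_def
  set XM := (∑ W ∈ U.powerset.filter (fun W => ∃ r ∈ ({m} : Finset V), r ∈ W), ν W * d W * x W) with hXM_def
  set YJ := (∑ W ∈ U.powerset.filter (fun W => (¬ ∃ r ∈ ({m} : Finset V), r ∈ W) ∧ ∃ r ∈ ent', r ∈ W), ν W * (c W - d W) * y W) with hYJ_def
  set YU := (∑ W ∈ U.powerset.filter (fun W => (¬ ∃ r ∈ ({m} : Finset V), r ∈ W) ∧ ∃ r ∈ ent', r ∈ W), ν W * d W * y W) with hYU_def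
  set YM := (∑ W ∈ U.powerset.filter (fun W => ∃ r ∈ ({m} : Finset V), r ∈ W), ν W * d W * y W) with hYM_def
  set XYU := (∑ W ∈ U.powerset.filter (fun W => (¬ ∃ r ∈ ({m} : Finset V), r ∈ W) ∧ ∃ r ∈ ent', r ∈ W), ν W * d W * (x W * y W)) with hXYU_def
  set XYM := (∑ W ∈ U.powerset.filter (fun W => ∃ r ∈ ({m} : Finset V), r ∈ W), ν W * d W * (x W * y W)) with hXYM_def
  have hcd0 : ∀ W, 0 ≤ c W - d W := fun W => by linarith [hdc W]
  have ha : 0 ≤ a := Finset.sum_nonneg (fun W _ => mul_nonneg (hν0 W) (hc0 W))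
  have hδ : 0 ≤ δ := Finset.sum_nonneg (fun W _ => mul_nonneg (hν0 W) (hcd0 W))
  have hu : 0 ≤ u := Finset.sum_nonneg (fun W _ => mul_nonneg (hν0 W) (hd0 W))
  have ht : 0 ≤ t := Finset.sum_nonneg (fun W _ => mul_nonneg (hν0 W) (hd0 W))
  have hXJ : 0 ≤ XJ := Finset.sum_nonneg (fun W _ => mul_nonneg (mul_nonneg (hν0 W) (hcd0 W)) (hx0 W))
  have hXU : 0 ≤ XU := Finset.sum_nonneg (fun W _ => mul_nonneg (mul_nonneg (hν0 W) (hd0 W)) (hx0 W))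
  have hXM : 0 ≤ XM := Finset.sum_nonneg (fun W _ => mul_nonneg (mul_nonneg (hν0 W) (hd0 W)) (hx0 W))
  have hYJ : 0 ≤ YJ := Finset.sum_nonneg (fun W _ => mul_nonneg (mul_nonneg (hν0 W) (hcd0 W)) (hy0 W))
  have hYU : 0 ≤ YU := Finset.sum_nonneg (fun W _ => mul_nonneg (mul_nonneg (hν0 W) (hd0 W)) (hy0 W))
  have hYM : 0 ≤ YM := Finset.sum_nonneg (fun W _ => mul_nonneg (mul_nonneg (hν0 W) (hd0 W)) (hy0 W))
  have hXYU : 0 ≤ XYU := Finset.sum_nonneg (fun W _ => mul_nonneg (mul_nonneg (hν0 W) (hd0 W)) (mul_nonneg (hx0 W) (hy0 W)))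
  have hXYM : 0 ≤ XYM := Finset.sum_nonneg (fun W _ => mul_nonneg (mul_nonneg (hν0 W) (hd0 W)) (mul_nonneg (hx0 W) (hy0 W)))
  have hXJδ : XJ ≤ δ := Finset.sum_le_sum (fun W _ => mul_le_of_le_one_right (mul_nonneg (hν0 W) (hcd0 W)) (hx1 W))
  have hYJδ : YJ ≤ δ := Finset.sum_le_sum (fun W _ => mul_le_of_le_one_right (mul_nonneg (hν0 W) (hcd0 W)) (hy1 W))
  have hXUu : XU ≤ u := Finset.sum_le_sum (fun W _ => mul_le_of_le_one_right (mul_nonneg (hν0 W) (hd0 W)) (hx1 W))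
  have hYUu : YU ≤ u := Finset.sum_le_sum (fun W _ => mul_le_of_le_one_right (mul_nonneg (hν0 W) (hd0 W)) (hy1 W))
  have hXMt : XM ≤ t := Finset.sum_le_sum (fun W _ => mul_le_of_le_one_right (mul_nonneg (hν0 W) (hd0 W)) (hx1 W))
  have hYMt : YM ≤ t := Finset.sum_le_sum (fun W _ => mul_le_of_le_one_right (mul_nonneg (hν0 W) (hd0 W)) (hy1 W))
  have hXYUx : XYU ≤ XU := Finset.sum_le_sum (fun W _ => by
    calc ν W * d W * (x W * y W) = (ν W * d W * x W) * y W := by ring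
      _ ≤ ν W * d W * x W := mul_le_of_le_one_right (mul_nonneg (mul_nonneg (hν0 W) (hd0 W)) (hx0 W)) (hy1 W))
  have hXYUy : XYU ≤ YU := Finset.sum_le_sum (fun W _ => by
    calc ν W * d W * (x W * y W) = (ν W * d W * y W) * x W := by ring
      _ ≤ ν W * d W * y W := mul_le_of_le_one_right (mul_nonneg (mul_nonneg (hν0 W) (hd0 W)) (hy0 W)) (hx1 W))
  have hXYMx : XYM ≤ XM := Finset.sum_le_sum (fun W _ => by
    calc ν W * d W * (x W * y W) = (ν W * d W * x W) * y W := by ring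
      _ ≤ ν W * d W * x W := mul_le_of_le_one_right (mul_nonneg (mul_nonneg (hν0 W) (hd0 W)) (hx0 W)) (hy1 W))
  have hXYMy : XYM ≤ YM := Finset.sum_le_sum (fun W _ => by
    calc ν W * d W * (x W * y W) = (ν W * d W * y W) * x W := by ring
      _ ≤ ν W * d W * y W := mul_le_of_le_one_right (mul_nonneg (mul_nonneg (hν0 W) (hd0 W)) (hy0 W)) (hx1 W))
  have hIEU := jj_box_ie U ν d (fun W => (¬ ∃ r ∈ ({m} : Finset V), r ∈ W) ∧ ∃ r ∈ ent', r ∈ W) x y hν0 hd0 hx1 hy1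
  -- the ideal carries no marker
  have hIx : (∑ W ∈ U.powerset.filter (fun W => ¬ ∃ r ∈ ({m} : Finset V) ∪ ent', r ∈ W), ν W * c W * x W) = 0 :=
    cgate_sum_zero U _ _ (fun W hW => by rw [hxI W hW, mul_zero])
  have hIy : (∑ W ∈ U.powerset.filter (fun W => ¬ ∃ r ∈ ({m} : Finset V) ∪ ent', r ∈ W), ν W * c W * y W) = 0 :=
    cgate_sum_zero U _ _ (fun W hW => by rw [hyI W hW, mul_zero])
  -- the five facts
  have FDD2 := cg_fact_DD2 U {m} ent' ν c d hν0 hν hc0 hd0 hcd x y hx0 hy0 hxm hym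
  have FMx := cg_fact_McM U {m} ent' ν c d hν0 hν hc0 hd0 hcd x hx0 hxm
  have FM2 := cg_fact_McM2 U {m} ent' ν c d hν0 hν hc0 hd0 hcd x y hx0 hy0 hxm hym
  have FIMx := cg_fact_JM2 U {m} ent' ν c d hν0 hν hc0 hd0 hdc hcd hratio x y hx0 hy0 hxm hym
  have FIMy := cg_fact_JM2 U {m} ent' ν c d hν0 hν hc0 hd0 hdc hcd hratio y x hy0 hx0 hym hxm
  rw [sum_entfree_split U {m} ent' (fun W => ν W * c W), cg_split' U ν c d (fun W => (¬ ∃ r ∈ ({m} : Finset V), r ∈ W) ∧ ∃ r ∈ ent', r ∈ W), cg_split U ν c d (fun W => (¬ ∃ r ∈ ({m} : Finset V), r ∈ W) ∧ ∃ r ∈ ent', r ∈ W) y] at FDD2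
  rw [sum_entfree_split U {m} ent' (fun W => ν W * c W), cg_split' U ν c d (fun W => (¬ ∃ r ∈ ({m} : Finset V), r ∈ W) ∧ ∃ r ∈ ent', r ∈ W), cg_split U ν c d (fun W => (¬ ∃ r ∈ ({m} : Finset V), r ∈ W) ∧ ∃ r ∈ ent', r ∈ W) x] at FMx
  rw [sum_entfree_split U {m} ent' (fun W => ν W * c W), cg_split' U ν c d (fun W => (¬ ∃ r ∈ ({m} : Finset V), r ∈ W) ∧ ∃ r ∈ ent', r ∈ W), cg_split U ν c d (fun W => (¬ ∃ r ∈ ({m} : Finset V), r ∈ W) ∧ ∃ r ∈ ent', r ∈ W) y] at FM2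
  rw [cg_entfree_piecewise U {m} ent' ν c d x, cg_entfree_piecewise' U {m} ent' ν c d, hIx, zero_add] at FIMx
  rw [cg_entfree_piecewise U {m} ent' ν c d y, cg_entfree_piecewise' U {m} ent' ν c d, hIy, zero_add] at FIMy
  have eyx : ∑ W ∈ U.powerset.filter (fun W => ∃ r ∈ ({m} : Finset V), r ∈ W), ν W * d W * (y W * x W) = XYM :=
    Finset.sum_congr rfl (fun W _ => by ring)
  rw [eyx] at FIMy
  -- the parts inequality
  have key := cg_jj_full a δ u t XJ XU XM YJ YU YM XYU XYM ha hδ hu ht hXJ hXU hXM hYJ hYU hYM hXYU hXYM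
    (by linarith) (by linarith) (by linarith) (by linarith) (by linarith) (by linarith)
    (by linarith) (by linarith) (by linarith) (by linarith) (by linarith)
    (by linear_combination FDD2) (by linear_combination FMx) (by linear_combination FM2)
    (by linear_combination FIMx) (by linear_combination FIMy)
  linear_combination key

end JjGateMain

end Summit.Ventures.PercRepro2.Coin
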